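import Summits.BirchSwinnertonDyer.BirchSwinnertonDyer.Theorems.KolyvaginRankRigidityAtTwoChebotarevTwoLevel
import Literature.GroupTheory.FiniteAbelian.IndependentGenerators
import HarnessLib

/-!
# Crux U1 `KolyvaginBoundedDefectAtTwo` (stmt-BirchSwinnertonDyer-28083), LINE 17 `regular_core_rigidity` v3,
# stub S1b `stub_nearCoreExistenceAtTwo` — ENGINE ADAPTER I: an independent basis of the restricted classes of a
# finite `τ`-stable group of Selmer classes (the input family of the value engine)

Width seat `bsd-line-krr2-p2` g14 (ONE READER on S1b); `--supports stmt-BirchSwinnertonDyer-28083` (helper). THEOREMS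
ONLY; nothing here proves S1b, U1, a rung or BSD. BSD is NOT proved.

The two-level value engine `exists_regular_kolyvaginPrime_values_twoLevel` (p688489) takes a family
`cs : Fin r → H¹(K, E[2^k])` whose RESTRICTIONS to `Γ_{K(E[2^(k+1)])}` (the functions `ρ ↦ [cs i, ρ] = h1Eval`)
are independent with exact orders `2^(e i)` (`he`, `hind`) and `τ`-stable through an integer matrix `Tm` (`hT`).
**`exists_restricted_basis`** produces such a family inside any finite `τ_*`-stable subgroup `S ≤ H¹(K, E[2^k])`,
together with the SPANNING property: every class of `S` has the restriction of an integer combination of the `cs i`.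
PROOF: the restriction `res : H¹(K, E[2^k]) → (Γ_{K(E[2^(k+1)])} → E[2^k])` is additive (`h1EvalHom`); the finite
abelian group `res(S)` has independent generators (the structure theorem, tree
`FiniteAbelian.exists_indep_generators`); their orders divide `2^k`; lift them to `S`; `τ_*`-stability of `S` gives
the matrix. [cite: McCallumLMS1991, Cor. 3.2, §5 p. 312] [cite: MazurRubin2004, §4.1]
Design: no definitions; `K : Type`; axioms `propext`, `Classical.choice`, `Quot.sound`.
-/

set_option autoImplicit false
-- the Theorems namespace of this sub repeats the summit name by design (D-0017 nested layout)
set_option linter.dupNamespace false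

noncomputable section

open scoped Classical
open Function WeierstrassCurve Field Finset
open Literature.NumberTheory.EllipticCurves Literature.NumberTheory.EllipticCurves.KolyvaginPairing
open Literature.NumberTheory.GaloisRepresentations

namespace Summit.BirchSwinnertonDyer.BirchSwinnertonDyer.Theorems.KolyvaginAtTwo.RegularValueEngine

universe u

variable {K : Type u} [Field K] [NumberField K] (W : WeierstrassCurve ℚ)

/-- **A RESTRICTED BASIS OF A FINITE `τ_*`-STABLE GROUP OF CLASSES** (input family of the value engine). For a finite
`S ≤ H¹(K, E[2^k])` with `τ_* S ⊆ S` there are `cs : Fin r → S`, a matrix `Tm` and exponents `e` with: the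
restrictions of `τ_* (cs i)` and `∑ j, Tm i j • cs j` to `Γ_{K(E[2^(k+1)])}` agree; `2^(e i)` kills the restriction
of `cs i`; a combination `∑ a i • cs i` restricting to zero has `2^(e i) ∣ a i`; and every `x ∈ S` restricts like some
`∑ a i • cs i`. [cite: McCallumLMS1991, Cor. 3.2, §5 p. 312] [cite: MazurRubin2004, §4.1] -/
theorem exists_restricted_basis {k : ℕ} (τ : K ≃ₐ[ℚ] K)
    (S : AddSubgroup (galH1Torsion (W.baseChange K) ((2 ^ k : ℕ) : ℤ))) [Finite S]
    (hSτ : ∀ x ∈ S, conjAct W τ ((2 ^ k : ℕ) : ℤ) x ∈ S) :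
    ∃ (r : ℕ) (cs : Fin r → galH1Torsion (W.baseChange K) ((2 ^ k : ℕ) : ℤ)) (Tm : Fin r → Fin r → ℤ)
      (e : Fin r → ℕ),
      (∀ i, cs i ∈ S) ∧
      (∀ i, ∀ ρ ∈ torsionFixing (W.baseChange K) ((2 ^ (k + 1) : ℕ) : ℤ),
        h1Eval (W.baseChange K) ((2 ^ k : ℕ) : ℤ) (conjAct W τ ((2 ^ k : ℕ) : ℤ) (cs i)) ρ =
          h1Eval (W.baseChange K) ((2 ^ k : ℕ) : ℤ) (∑ j, Tm i j • cs j) ρ) ∧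
      (∀ i, ∀ ρ ∈ torsionFixing (W.baseChange K) ((2 ^ (k + 1) : ℕ) : ℤ),
        (2 : ℤ) ^ e i • h1Eval (W.baseChange K) ((2 ^ k : ℕ) : ℤ) (cs i) ρ = 0) ∧
      (∀ a : Fin r → ℤ, (∀ ρ ∈ torsionFixing (W.baseChange K) ((2 ^ (k + 1) : ℕ) : ℤ),
        h1Eval (W.baseChange K) ((2 ^ k : ℕ) : ℤ) (∑ i, a i • cs i) ρ = 0) → ∀ i, (2 : ℤ) ^ e i ∣ a i) ∧
      (∀ x ∈ S, ∃ a : Fin r → ℤ, ∀ ρ ∈ torsionFixing (W.baseChange K) ((2 ^ (k + 1) : ℕ) : ℤ),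
        h1Eval (W.baseChange K) ((2 ^ k : ℕ) : ℤ) x ρ =
          h1Eval (W.baseChange K) ((2 ^ k : ℕ) : ℤ) (∑ i, a i • cs i) ρ) := by
  haveI hSfin : Finite S := inferInstance
  let n : ℤ := ((2 ^ k : ℕ) : ℤ)
  let TF := torsionFixing (W.baseChange K) ((2 ^ (k + 1) : ℕ) : ℤ)
  have hle : TF ≤ torsionFixing (W.baseChange K) n :=
    KolyvaginLowerBoundAtTwo.torsionFixing_le_of_dvd _ ⟨2, by simp only [n]; push_cast; ring⟩
  -- the restriction homomorphism
  let res : galH1Torsion (W.baseChange K) n →+ (TF → geomTorsion (W.baseChange K) n) :=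
    AddMonoidHom.pi fun ρ : TF ↦ h1EvalHom (W.baseChange K) n (hle ρ.2)
  have hres : ∀ x (ρ : TF), res x ρ = h1Eval (W.baseChange K) n x ρ := fun _ _ ↦ rfl
  have hres' : ∀ x y : galH1Torsion (W.baseChange K) n,
      res x = res y ↔ ∀ ρ ∈ TF, h1Eval (W.baseChange K) n x ρ = h1Eval (W.baseChange K) n y ρ := fun x y ↦ by
    constructor
    · intro h ρ hρ
      have := congrFun h ⟨ρ, hρ⟩
      rwa [hres, hres] at this
    · intro h
      funext ρ
      rw [hres, hres]
      exact h ρ ρ.2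
  -- the finite group `G = res(S)` and its independent generators
  set G := S.map res with hG
  haveI : Finite G := by
    refine Finite.of_surjective (fun x : ↥S ↦ (⟨res x, AddSubgroup.mem_map_of_mem res x.2⟩ : G)) ?_
    rintro ⟨y, hy⟩
    obtain ⟨x, hx, rfl⟩ := AddSubgroup.mem_map.mp hy
    exact ⟨⟨x, hx⟩, rfl⟩
  obtain ⟨ι, _, g, hind, hgen⟩ := Literature.GroupTheory.FiniteAbelian.exists_indep_generators (G := G)
  -- reindex by `Fin r`
  set r := Fintype.card ι with hr
  let σ : ι ≃ Fin r := Fintype.equivFin ι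
  let g' : Fin r → G := fun j ↦ g (σ.symm j)
  have hind' : ∀ a : Fin r → ℤ, ∑ j, a j • g' j = 0 → ∀ j, (addOrderOf (g' j) : ℤ) ∣ a j := by
    intro a ha j
    have h := hind (fun i ↦ a (σ i)) (by
      rw [← ha, ← Equiv.sum_comp σ.symm]
      exact Finset.sum_congr rfl fun j _ ↦ by rw [Equiv.apply_symm_apply])
    have := h (σ.symm j)
    rwa [Equiv.apply_symm_apply] at this
  have hgen' : ∀ x : G, ∃ a : Fin r → ℤ, x = ∑ j, a j • g' j := by
    intro x
    obtain ⟨a, ha⟩ := hgen x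
    refine ⟨fun j ↦ a (σ.symm j), ?_⟩
    rw [ha, ← Equiv.sum_comp σ.symm]
  -- lifts of the generators
  have hlift : ∀ j, ∃ c ∈ S, res c = (g' j : TF → geomTorsion (W.baseChange K) n) :=
    fun j ↦ AddSubgroup.mem_map.mp (g' j).2
  choose cs hcsS hcs using hlift
  -- orders are powers of two
  have h2k : ∀ x : G, (2 ^ k) • x = 0 := by
    intro x
    apply Subtype.ext
    rw [AddSubgroup.coe_nsmul, AddSubgroup.coe_zero]
    funext ρ
    rw [Pi.smul_apply, Pi.zero_apply]
    have := (W.baseChange K).natAbs_nsmul_geomTorsion ((x : TF → geomTorsion (W.baseChange K) n) ρ)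
    rwa [Int.natAbs_natCast] at this
  have he : ∀ j, ∃ e : ℕ, e ≤ k ∧ addOrderOf (g' j) = 2 ^ e :=
    fun j ↦ (Nat.dvd_prime_pow Nat.prime_two).mp (addOrderOf_dvd_of_nsmul_eq_zero (h2k (g' j)))
  choose e _ he using he
  -- the matrix of `τ_*`
  have hTm : ∀ i, ∃ a : Fin r → ℤ,
      (⟨res (conjAct W τ n (cs i)), AddSubgroup.mem_map_of_mem res (hSτ _ (hcsS i))⟩ : G) = ∑ j, a j • g' j :=
    fun i ↦ hgen' ⟨res (conjAct W τ n (cs i)), AddSubgroup.mem_map_of_mem res (hSτ _ (hcsS i))⟩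
  choose Tm hTm using hTm
  -- sums of lifts restrict to sums of generators
  have hsum : ∀ a : Fin r → ℤ, res (∑ j, a j • cs j) = ((∑ j, a j • g' j : G) : TF → geomTorsion (W.baseChange K) n) := by
    intro a
    rw [map_sum, AddSubgroup.val_finsetSum]
    refine Finset.sum_congr rfl fun j _ ↦ ?_
    rw [map_zsmul, AddSubgroup.coe_zsmul, hcs]
  refine ⟨r, cs, Tm, e, hcsS, fun i ρ hρ ↦ ?_, fun i ρ hρ ↦ ?_, fun a ha i ↦ ?_, fun x hx ↦ ?_⟩
  · -- `hT`
    have h := congrArg (fun y : G ↦ (y : TF → geomTorsion (W.baseChange K) n) ⟨ρ, hρ⟩) (hTm i)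
    simp only at h
    rw [← hsum, hres, hres] at h
    exact h
  · -- `he`
    have h := addOrderOf_nsmul_eq_zero (g' i)
    rw [he i] at h
    have h' := congrArg (fun y : G ↦ (y : TF → geomTorsion (W.baseChange K) n) ⟨ρ, hρ⟩) h
    simp only [AddSubgroup.coe_nsmul, Pi.smul_apply, AddSubgroup.coe_zero, Pi.zero_apply] at h'
    rw [← hcs, hres] at h'
    rw [← natCast_zsmul, Nat.cast_pow, Nat.cast_ofNat] at h'
    exact h'
  · -- `hind`
    have h0 : (∑ j, a j • g' j : G) = 0 := by
      apply Subtype.ext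
      rw [← hsum, AddSubgroup.coe_zero]
      funext ρ
      rw [hres, Pi.zero_apply]
      exact ha ρ ρ.2
    have h := hind' a h0 i
    rw [he i] at h
    exact_mod_cast h
  · -- spanning
    obtain ⟨a, ha⟩ := hgen' ⟨res x, AddSubgroup.mem_map_of_mem res hx⟩
    refine ⟨a, fun ρ hρ ↦ ?_⟩
    have h := congrArg (fun y : G ↦ (y : TF → geomTorsion (W.baseChange K) n) ⟨ρ, hρ⟩) ha
    simp only at h
    rw [← hsum, hres, hres] at h
    exact h

end Summit.BirchSwinnertonDyer.BirchSwinnertonDyer.Theorems.KolyvaginAtTwo.RegularValueEngine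

end
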